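/-
Copyright: see repository. [cite: CossartPiltant2008, Section 9, Lemma 9.4 (HAL p. 29 l. 48–49)]
[cite: Matsumura1987, Theorem 5.1 (Section 5)]
-/
import Literature.AlgebraicGeometry.CossartPiltant200819.MonomialChartMatsumura2008
import HarnessLib

/-!
# [CP-I] Lemma 9.4, §9 monomial chart: the two remaining named leaves DISCHARGED

`MonomialChartMatsumura2008` proves Matsumura's Theorem 5.1 (ii) (`kernelAtAlgebraicPoint`) and from
it the kernel leaf `monomialChartKernel : MonomialChartKernel`, the regularity node
`monomialChartRegular` and the Roots leaf `tamePrimeDescentViaStableModelRoots`; the two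
intermediate named facts of the same chain,

* `MonomialChartIdeal` (node N2a″, `MonomialChartFibre2008`: the centre `m_W ∩ S[y]` of `W` on the
  affine chart `S̄ = S[y]` is generated by the `y_i` with `W(y_i) > 0` and `#I₀`-many polynomial
  values `P_j(y_{I₀})`), and
* `MonomialChartCentreSelf` (node N2a′, `MonomialChartLift2008`: the same generators for the maximal
  ideal of the pinned chart `S₁ = (S[y])_{m_W ∩ S[y]}`),

were left without their `_holds` theorems although the tree already contains the reductions
`monomialChartIdeal_of_kernel : MonomialChartKernel → MonomialChartIdeal` and
`monomialChartCentreSelf_of_kernel : MonomialChartKernel → MonomialChartCentreSelf`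
(`MonomialChartKernel2008`).  This leaf file records the two one-line discharges; no definitions,
no new named facts. [cite: CossartPiltant2008, Section 9, Lemma 9.4 (HAL p. 29 l. 48–49)]
[cite: Matsumura1987, Theorem 5.1 (ii) (Section 5)]
-/

namespace Literature.AlgebraicGeometry.CossartPiltant200819.CP2008

universe u

/-- **Node N2a″ `MonomialChartIdeal` DISCHARGED** ([CP-I] HAL p. 29 l. 48–49: "`S̄ := S[y₁, y₂, y₃]`.
By (c), `S₁ := S̄_{m_W ∩ S̄}` is a local model of `W`"; the centre of `W` on `S[y]` is
`(y_{I₊}, P_1(y_{I₀}), …, P_m(y_{I₀}))` with `#I₊ + m = d`), from the proved kernel leaf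
`monomialChartKernel` (Matsumura Thm. 5.1 (ii)) by `monomialChartIdeal_of_kernel`.
[cite: CossartPiltant2008, Section 9, Lemma 9.4 (HAL p. 29 l. 48–49)]
[cite: Matsumura1987, Theorem 5.1 (ii) (Section 5)] -/
theorem MonomialChartIdeal_holds : MonomialChartIdeal.{u} :=
  monomialChartIdeal_of_kernel monomialChartKernel

/-- **Node N2a′ `MonomialChartCentreSelf` DISCHARGED** ([CP-I] HAL p. 29 l. 48–49, generator form for
the maximal ideal of the pinned chart `S₁ = (S[y])_{m_W ∩ S[y]}`), from the proved kernel leaf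
`monomialChartKernel` by `monomialChartCentreSelf_of_kernel`
(= `monomialChartCentreSelf_of_ideal ∘ monomialChartIdeal_of_kernel`).
[cite: CossartPiltant2008, Section 9, Lemma 9.4 (HAL p. 29 l. 48–49)]
[cite: Matsumura1987, Theorem 5.1 (ii) (Section 5)] -/
theorem MonomialChartCentreSelf_holds : MonomialChartCentreSelf.{u} :=
  monomialChartCentreSelf_of_kernel monomialChartKernel

end Literature.AlgebraicGeometry.CossartPiltant200819.CP2008
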